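import Summits.CriticalPhenomena.PercolationContinuityZ3.Theorems.FK.EdgeDensityDerivative
import Literature.Probability.LatticeModels.RandomClusterComparison
import Literature.Probability.Percolation.PercolationSteepness
import Mathlib.Combinatorics.SetFamily.FourFunctions
import HarnessLib

/-!
# Exponential steepness for the random-cluster measure `φ^B_{G,p,q}`, `q ≥ 1`, 1/2 (Grimmett 2006, Thm. (3.42) =
# Thm. (2.53) for `φ_{p,q}`): `d/dp log φ_{p,q}(A) ≥ φ_{p,q}(H_A)/(p(1-p))`, covariance and derivative forms

Claimed R42 (8)(c) in the cell INBOX at 2026-08-27T11:05:32Z by fkp-10a gen 349 under provision (ι) (no coordinator fk-4 seated after g251 closed l.8021 2026-08-27T10:12Z; the lane lead absorbs the registry word; silence = consent; a seated coordinator’s word would govern); lineage row FO-10a-g349 (self-suggested), package g349-steepness, label ST-A.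
Support file of the `fk-continuity` cell (lineage fkp-10a, `--supports stmt-CriticalPhenomena-4575`); builds on
p205010 (kernel theorem, internal audit signed; external expert review pending).  No definitions, no named facts,
no sorries; standard axioms.  UNCONDITIONAL finite-graph random-cluster theory (`q ≥ 1`).

Grimmett 2006, §2.5/§3.5.  For an increasing event `A` let `H_A(ω)` be the Hamming distance from `ω` to `A` (the
least number of further edges whose opening puts `ω` in `A`, (2.51)–(2.52)).  **Theorem (3.42)** [(2.53) for the
random-cluster measure, `q ≥ 1`]: `d/dp log φ_{p,q}(A) ≥ φ_{p,q}(H_A)/(p(1-p))` (3.43).  The Literature file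
`Percolation/PercolationSteepness.lean` treats ONLY Bernoulli product measure (its `TODO(general form)`); this file
is the random-cluster case, for the tree's finite-volume measure `rcMeasure G p q B` with ANY wired set `B` (so it
covers every boundary condition of a region at once).  As there, the Hamming distance enters through its layer cake:
`Steepness.withinDist F A k = {H_A^F ≤ k}` (the event that `A` is entered by opening at most `k` further edges of the
finite edge set `F` determining `A`), and `φ(H_A^F) = Σ_{k<|F|} (1 - φ(withinDist F A k))`.  The integrated form
(3.44) is the companion file `SteepnessIntegratedFK.lean`; the sprinkling Theorem (3.45) is `SprinklingFK.lean`.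

Proof (Grimmett's, p. 43): Russo's formula in covariance form `d/dp φ_p(A) = cov_p(|η|, 1_A)/(p(1-p))` (the tree's
`hasDerivAt_rcMeasure_real`, Thm. (2.43)); `|η| + H_A` is non-decreasing and `H_A 1_A = 0`, so by FKG FOR MONOTONE
FUNCTIONS (proved here for `rcExpect` from Mathlib's `fkg` and the tree's lattice condition
`rcWeight_lattice_condition`) `cov(|η|, 1_A) ≥ -cov(H_A, 1_A) = φ(H_A) φ(A)`.

## Contents (namespace `Summit.CriticalPhenomena.PercolationContinuityZ3.Theorems.FK`)

* `sum_ite_rcWeight_mul`, **`rcExpect_mul_rcExpect_le_of_monotone`** (FKG for monotone functions, Thm. (3.8)(a)),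
  `rcExpect_mul_real_le_of_monotone`;
* the Hamming distance: `union_mem_of_determinedBy`, `mem_withinDist_card` (`H_A^F ≤ |F|`),
  `mem_withinDist_add_of_subset` (`H(ω) ≤ H(ω') + |ω' ∖ ω|` for `ω ⊆ ω'`), `exists_mem_withinDist`;
* **`rcMeasure_real_mul_sum_le_cov`** ((3.43) in covariance form: `φ(A) Σ_k (1 - φ(W_k)) ≤ cov(|η|, 1_A)`),
  `rcMeasure_real_pos_of_nonempty`, **`hasDerivAt_rcMeasure_real_and_mul_sum_le`** ((3.43) with the derivative).

## References

* G. Grimmett, *The Random-Cluster Model*, Springer 2006: §2.5 (2.51)–(2.56), Thm. (2.53); §3.5 Thms. (3.42), (3.45),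
  (3.43)–(3.47) and the proof (3.50)–(3.54), pp. 42–43, 53–55; Thm. (2.43)/(3.12) (Russo's formula); Thm. (3.1)
  (3.3)–(3.4); Thm. (3.8) (FKG, strong positive association). [Grimmett2006]
* G. R. Grimmett, M. S. T. Piza, *Decay of correlations in subcritical Potts and random-cluster models*,
  Comm. Math. Phys. 189 (1997) 465–480 (Grimmett's [163]). [GrimmettPiza1997]
* G. Grimmett, *Percolation*, 2nd ed., Springer 1999, §2.6 Thm. (2.45), §2.7 p. 52. [GrimmettPercolation1999]
-/

noncomputable section

open scoped Classical
open MeasureTheory Finset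

namespace Summit.CriticalPhenomena.PercolationContinuityZ3.Theorems

namespace FK

open Literature.Probability.LatticeModels Literature.Probability.Percolation
  Literature.Probability.Percolation.Steepness

section FiniteGraph

variable {V : Type*} [Fintype V] [DecidableEq V] (G : SimpleGraph V) [DecidableRel G.Adj]

/-! ### FKG for monotone functions under `φ^B_{G,p,q}` -/

/-- The weight `w` extended by `0` off the edge sets of `G`, integrated against `h` over ALL edge sets, is
`Z · E^B_{G,p,q}[h]`. [cite: Grimmett2006, §1.2 eq. (1.2)–(1.3)] -/
theorem sum_ite_rcWeight_mul (p q : ℝ) (B : Set V) (h : Finset (Sym2 V) → ℝ)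
    (hZ : rcPartitionFunction G p q B ≠ 0) :
    ∑ ω, (if ω ⊆ G.edgeFinset then rcWeight G p q B ω else 0) * h ω =
      rcPartitionFunction G p q B * rcExpect G p q B h := by
  have hfilter : (Finset.univ : Finset (Finset (Sym2 V))).filter (· ⊆ G.edgeFinset) =
      G.edgeFinset.powerset := by
    ext ω; simp
  have h1 : ∑ ω, (if ω ⊆ G.edgeFinset then rcWeight G p q B ω else 0) * h ω =
      ∑ ω ∈ G.edgeFinset.powerset, rcWeight G p q B ω * h ω := by
    rw [← hfilter, Finset.sum_filter]
    refine Finset.sum_congr rfl fun ω _ => ?_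
    split_ifs <;> simp
  rw [h1, rcExpect, Finset.mul_sum]
  refine Finset.sum_congr rfl fun ω _ => ?_
  field_simp

/-- **FKG for monotone functions** (Grimmett 2006, Thm. (3.8)(a): `φ_{p,q}` is positively associated for
`q ≥ 1`): for nonnegative functions `f, g` that are non-decreasing on the lattice of edge sets,
`E[f] E[g] ≤ E[f g]` under `φ^B_{G,p,q}`, `0 ≤ p ≤ 1`, `q ≥ 1`, any wired set `B` (Mathlib's `fkg` with the tree's
lattice condition `rcWeight_lattice_condition`). [cite: Grimmett2006, Thm. (3.8)(a)] -/
theorem rcExpect_mul_rcExpect_le_of_monotone {p q : ℝ} (hp : p ∈ Set.Icc (0 : ℝ) 1) (hq : 1 ≤ q) (B : Set V)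
    {f g : Finset (Sym2 V) → ℝ} (hf0 : 0 ≤ f) (hg0 : 0 ≤ g) (hf : Monotone f) (hg : Monotone g) :
    rcExpect G p q B f * rcExpect G p q B g ≤ rcExpect G p q B (fun ω => f ω * g ω) := by
  have hq0 : 0 < q := one_pos.trans_le hq
  have hZ := rcPartitionFunction_pos G hp hq0 B
  set w : Finset (Sym2 V) → ℝ := fun ω => if ω ⊆ G.edgeFinset then rcWeight G p q B ω else 0 with hw
  have hw0 : 0 ≤ w := fun ω => rcWeight_ite_nonneg G hp hq0.le B ω
  have key := fkg f g w hw0 hf0 hg0 hf hg (fun a b => rcWeight_lattice_condition G hp hq B a b)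
  have h1 := sum_ite_rcWeight_mul G p q B f hZ.ne'
  have h2 := sum_ite_rcWeight_mul G p q B g hZ.ne'
  have h3 := sum_ite_rcWeight_mul G p q B (fun ω => f ω * g ω) hZ.ne'
  have h4 : ∑ ω, w ω = rcPartitionFunction G p q B := by
    have := sum_ite_rcWeight_mul G p q B (fun _ => 1) hZ.ne'
    simp only [mul_one] at this
    rw [this, rcExpect_const G hp hq0 B, mul_one]
  have h1' : ∑ ω, w ω * f ω = rcPartitionFunction G p q B * rcExpect G p q B f := h1
  have h2' : ∑ ω, w ω * g ω = rcPartitionFunction G p q B * rcExpect G p q B g := h2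
  have h3' : ∑ ω, w ω * (f ω * g ω) = rcPartitionFunction G p q B * rcExpect G p q B (fun ω => f ω * g ω) := h3
  rw [h1', h2', h3', h4] at key
  have key' : rcPartitionFunction G p q B * rcPartitionFunction G p q B *
      (rcExpect G p q B f * rcExpect G p q B g) ≤
      rcPartitionFunction G p q B * rcPartitionFunction G p q B * rcExpect G p q B (fun ω => f ω * g ω) := by
    calc rcPartitionFunction G p q B * rcPartitionFunction G p q B * (rcExpect G p q B f * rcExpect G p q B g)
        = rcPartitionFunction G p q B * rcExpect G p q B f * (rcPartitionFunction G p q B * rcExpect G p q B g) := by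
          ring
      _ ≤ rcPartitionFunction G p q B * (rcPartitionFunction G p q B * rcExpect G p q B (fun ω => f ω * g ω)) := key
      _ = _ := by ring
  exact le_of_mul_le_mul_left key' (mul_pos hZ hZ)

/-- Covariance form of FKG for monotone functions: `E[f] E[g] ≤ E[f g]`, i.e. `cov(f, g) ≥ 0`, where `g` is the
indicator of an increasing event and `f ≥ 0` is non-decreasing. [cite: Grimmett2006, Thm. (3.8)(a)] -/
theorem rcExpect_mul_real_le_of_monotone {p q : ℝ} (hp : p ∈ Set.Icc (0 : ℝ) 1) (hq : 1 ≤ q) (B : Set V)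
    {f : Finset (Sym2 V) → ℝ} (hf0 : 0 ≤ f) (hf : Monotone f) {A : Set (BondConfig V)} (hA : IsUpperSet A) :
    rcExpect G p q B f * (rcMeasure G p q B).real A ≤
      rcExpect G p q B (fun ω => f ω * if (↑ω : BondConfig V) ∈ A then 1 else 0) := by
  have hq0 : 0 < q := one_pos.trans_le hq
  rw [rcMeasure_real_eq_rcExpect G hp hq0 B A]
  refine rcExpect_mul_rcExpect_le_of_monotone G hp hq B hf0 (fun ω => by positivity) hf ?_
  intro a b hab
  by_cases ha : (↑a : BondConfig V) ∈ A
  · have hb : (↑b : BondConfig V) ∈ A := hA (Finset.coe_subset.2 hab) ha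
    simp [ha, hb]
  · simp only [ha, if_false]
    split_ifs <;> norm_num

/-! ### The Hamming distance to an increasing event through its layer cake `withinDist F A k = {H_A^F ≤ k}` -/

omit [Fintype V] [DecidableEq V] in
/-- For an increasing event `A ∋ ζ` determined by `F`: `ω ∪ F ∈ A` for every `ω` (it agrees with `ζ ∪ F ∈ A` on
`F`). [cite: Grimmett2006, §2.5 (2.52)] -/
theorem union_mem_of_determinedBy {F : Finset (Sym2 V)} {A : Set (BondConfig V)} (hA : IsUpperSet A)
    (hAF : DeterminedBy A (↑F : Set (Sym2 V))) {ζ : BondConfig V} (hζ : ζ ∈ A) (ω : BondConfig V) :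
    ω ∪ ↑F ∈ A := by
  have h1 : ζ ∪ ↑F ∈ A := hA Set.subset_union_left hζ
  refine ((determinedBy_iff A ↑F).1 hAF (ω ∪ ↑F) (ζ ∪ ↑F) ?_).2 h1
  rw [Set.union_inter_cancel_right, Set.union_inter_cancel_right]

omit [Fintype V] [DecidableEq V] in
/-- `H_A^F ≤ |F|`: every configuration lies in `withinDist F A |F|` when `A` is non-empty, increasing and
determined by `F`. [cite: Grimmett2006, §2.5 (2.52)] -/
theorem mem_withinDist_card {F : Finset (Sym2 V)} {A : Set (BondConfig V)} (hA : IsUpperSet A)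
    (hAF : DeterminedBy A (↑F : Set (Sym2 V))) (hne : A.Nonempty) (ω : BondConfig V) :
    ω ∈ withinDist F A F.card := by
  obtain ⟨ζ, hζ⟩ := hne
  exact ⟨F, Finset.Subset.refl _, le_rfl, union_mem_of_determinedBy hA hAF hζ ω⟩

omit [Fintype V] in
/-- **`H_A(ω) ≤ H_A(ω') + |ω' ∖ ω|` for `ω ⊆ ω'`** (Grimmett 2006, §2.5 fact (ii): adding one open edge lowers
`H_A` by at most one): if `ω' ∈ withinDist F A k` then `ω ∈ withinDist F A (k + |ω' ∖ ω|)`.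
[cite: Grimmett2006, §2.5 (ii) p. 42] -/
theorem mem_withinDist_add_of_subset {F : Finset (Sym2 V)} {A : Set (BondConfig V)}
    (hAF : DeterminedBy A (↑F : Set (Sym2 V))) {ω ω' : Finset (Sym2 V)} (hsub : ω ⊆ ω') {k : ℕ}
    (h : (↑ω' : BondConfig V) ∈ withinDist F A k) :
    (↑ω : BondConfig V) ∈ withinDist F A (k + (ω' \ ω).card) := by
  obtain ⟨S, hSF, hSk, hS⟩ := h
  refine ⟨(ω' \ ω) ∩ F ∪ S, ?_, ?_, ?_⟩
  · exact Finset.union_subset (Finset.inter_subset_right) hSF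
  · calc ((ω' \ ω) ∩ F ∪ S).card ≤ ((ω' \ ω) ∩ F).card + S.card := Finset.card_union_le _ _
      _ ≤ (ω' \ ω).card + k := add_le_add (Finset.card_le_card Finset.inter_subset_left) hSk
      _ = k + (ω' \ ω).card := add_comm _ _
  · -- `ω ∪ ((ω'∖ω) ∩ F) ∪ S` and `ω' ∪ S` agree on `F`
    refine ((determinedBy_iff A ↑F).1 hAF _ _ ?_).2 hS
    ext e
    simp only [Finset.coe_union, Finset.coe_inter, Finset.coe_sdiff, Set.mem_inter_iff, Set.mem_union,
      Set.mem_sdiff, Finset.mem_coe]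
    constructor
    · rintro ⟨h1 | ⟨⟨h2, -⟩, -⟩ | h3, he⟩
      · exact ⟨Or.inl (hsub h1), he⟩
      · exact ⟨Or.inl h2, he⟩
      · exact ⟨Or.inr h3, he⟩
    · rintro ⟨h1 | h3, he⟩
      · by_cases hω : e ∈ ω
        · exact ⟨Or.inl hω, he⟩
        · exact ⟨Or.inr (Or.inl ⟨⟨h1, hω⟩, he⟩), he⟩
      · exact ⟨Or.inr (Or.inr h3), he⟩

omit [Fintype V] [DecidableEq V] in
/-- Existence of the Hamming distance (some `k` with `ω ∈ withinDist F A k`). [cite: Grimmett2006, §2.5 (2.51)] -/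
theorem exists_mem_withinDist {F : Finset (Sym2 V)} {A : Set (BondConfig V)} (hA : IsUpperSet A)
    (hAF : DeterminedBy A (↑F : Set (Sym2 V))) (hne : A.Nonempty) (ω : BondConfig V) :
    ∃ k, ω ∈ withinDist F A k :=
  ⟨F.card, mem_withinDist_card hA hAF hne ω⟩

/-! ### Theorem (3.42): exponential steepness, covariance and derivative forms -/

/-- **Exponential steepness for `φ^B_{G,p,q}` in covariance form** (Grimmett 2006, Thm. (3.42)/(2.53), the display
on p. 43): for `0 ≤ p ≤ 1`, `q ≥ 1`, any wired set `B`, and a non-empty increasing event `A` determined by a finite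
edge set `F`,
`φ(A) · Σ_{k<|F|} (1 - φ(withinDist F A k)) ≤ E[|ω| 1_A] - E|ω| · φ(A) = cov(|η|, 1_A)`,
the left factor `Σ_k (1 - φ{H_A ≤ k}) = φ(H_A^F)` being the mean Hamming distance to `A`.  Proof: `|η| + H_A` is
non-decreasing (`mem_withinDist_add_of_subset`) and `H_A 1_A = 0`, so FKG for monotone functions gives
`cov(|η| + H_A, 1_A) ≥ 0`, i.e. `cov(|η|, 1_A) ≥ -cov(H_A, 1_A) = φ(H_A) φ(A)`.
[cite: Grimmett2006, Thm. (3.42) eq. (3.43); Thm. (2.53) proof p. 43] -/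
theorem rcMeasure_real_mul_sum_le_cov {p q : ℝ} (hp : p ∈ Set.Icc (0 : ℝ) 1) (hq : 1 ≤ q) (B : Set V)
    {F : Finset (Sym2 V)} {A : Set (BondConfig V)} (hA : IsUpperSet A)
    (hAF : DeterminedBy A (↑F : Set (Sym2 V))) (hne : A.Nonempty) :
    (rcMeasure G p q B).real A * ∑ k ∈ Finset.range F.card, (1 - (rcMeasure G p q B).real (withinDist F A k)) ≤
      rcExpect G p q B (fun ω => (ω.card : ℝ) * if (↑ω : BondConfig V) ∈ A then 1 else 0) -
        rcExpect G p q B (fun ω => (ω.card : ℝ)) * (rcMeasure G p q B).real A := by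
  have hq0 : 0 < q := one_pos.trans_le hq
  -- the Hamming distance as a `Nat.find`
  have hex : ∀ ω : Finset (Sym2 V), ∃ k, (↑ω : BondConfig V) ∈ withinDist F A k :=
    fun ω => exists_mem_withinDist hA hAF hne _
  set hd : Finset (Sym2 V) → ℕ := fun ω => Nat.find (hex ω) with hhd
  have hd_spec : ∀ ω, (↑ω : BondConfig V) ∈ withinDist F A (hd ω) := fun ω => Nat.find_spec (hex ω)
  have hd_le_iff : ∀ ω k, hd ω ≤ k ↔ (↑ω : BondConfig V) ∈ withinDist F A k := by
    intro ω k
    constructor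
    · intro h; exact withinDist_mono h (hd_spec ω)
    · intro h; exact Nat.find_min' (hex ω) h
  have hd_le_card : ∀ ω, hd ω ≤ F.card := fun ω => (hd_le_iff ω _).2 (mem_withinDist_card hA hAF hne _)
  have hd_zero_of_mem : ∀ ω : Finset (Sym2 V), (↑ω : BondConfig V) ∈ A → hd ω = 0 := fun ω hω =>
    Nat.le_zero.1 ((hd_le_iff ω 0).2 (by rwa [withinDist_zero]))
  -- `|ω| + H(ω)` is non-decreasing
  set f : Finset (Sym2 V) → ℝ := fun ω => (ω.card : ℝ) + (hd ω : ℝ) with hf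
  have hf0 : 0 ≤ f := fun ω => by positivity
  have hfm : Monotone f := by
    intro a b hab
    have h1 : hd a ≤ hd b + (b \ a).card :=
      (hd_le_iff a _).2 (mem_withinDist_add_of_subset hAF hab (hd_spec b))
    have h2 : (b \ a).card = b.card - a.card := Finset.card_sdiff_of_subset hab
    have h3 : a.card ≤ b.card := Finset.card_le_card hab
    have h4 : hd a + a.card ≤ hd b + b.card := by omega
    have h5 : ((hd a : ℕ) : ℝ) + (a.card : ℝ) ≤ (hd b : ℝ) + (b.card : ℝ) := by exact_mod_cast h4
    show (a.card : ℝ) + (hd a : ℝ) ≤ (b.card : ℝ) + (hd b : ℝ)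
    linarith
  -- FKG: `E[f] φ(A) ≤ E[f 1_A]`
  have hfkg := rcExpect_mul_real_le_of_monotone G hp hq B hf0 hfm hA
  -- `E[f 1_A] = E[|ω| 1_A]` since `H 1_A = 0`
  have hf1 : rcExpect G p q B (fun ω => f ω * if (↑ω : BondConfig V) ∈ A then 1 else 0) =
      rcExpect G p q B (fun ω => (ω.card : ℝ) * if (↑ω : BondConfig V) ∈ A then 1 else 0) := by
    refine rcExpect_congr G p q B fun ω _ => ?_
    by_cases hω : (↑ω : BondConfig V) ∈ A
    · simp [hf, hω, hd_zero_of_mem ω hω]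
    · simp [hω]
  -- `E[f] = E|ω| + E[H]` and `E[H] = Σ_k (1 - φ(W_k))`
  have hf2 : rcExpect G p q B f = rcExpect G p q B (fun ω => (ω.card : ℝ)) +
      rcExpect G p q B (fun ω => (hd ω : ℝ)) := rcExpect_add G p q B _ _
  have hlayer : ∀ ω : Finset (Sym2 V), (hd ω : ℝ) =
      ∑ k ∈ Finset.range F.card, (1 - if (↑ω : BondConfig V) ∈ withinDist F A k then (1 : ℝ) else 0) := by
    intro ω
    have h1 : ∀ k, (1 - if (↑ω : BondConfig V) ∈ withinDist F A k then (1 : ℝ) else 0) =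
        if k < hd ω then (1 : ℝ) else 0 := by
      intro k
      by_cases hk : k < hd ω
      · have : ¬ (↑ω : BondConfig V) ∈ withinDist F A k := fun h => by
          have := (hd_le_iff ω k).2 h; omega
        simp [hk, this]
      · have : (↑ω : BondConfig V) ∈ withinDist F A k := (hd_le_iff ω k).1 (by omega)
        simp [hk, this]
    simp_rw [h1]
    rw [Finset.sum_ite, Finset.sum_const_zero, add_zero, Finset.sum_const, nsmul_eq_mul, mul_one]
    have : (Finset.range F.card).filter (fun k => k < hd ω) = Finset.range (hd ω) := by
      ext k
      simp only [Finset.mem_filter, Finset.mem_range]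
      constructor
      · exact fun h => h.2
      · exact fun h => ⟨lt_of_lt_of_le h (hd_le_card ω), h⟩
    rw [this, Finset.card_range]
  have hf3 : rcExpect G p q B (fun ω => (hd ω : ℝ)) =
      ∑ k ∈ Finset.range F.card, (1 - (rcMeasure G p q B).real (withinDist F A k)) := by
    rw [show (fun ω => (hd ω : ℝ)) = fun ω : Finset (Sym2 V) =>
        ∑ k ∈ Finset.range F.card, (1 - if (↑ω : BondConfig V) ∈ withinDist F A k then (1 : ℝ) else 0) from
      funext hlayer, rcExpect_finset_sum]
    refine Finset.sum_congr rfl fun k _ => ?_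
    rw [rcExpect_sub, rcExpect_const G hp hq0 B, rcMeasure_real_eq_rcExpect G hp hq0 B]
  rw [hf1, hf2, hf3] at hfkg
  linarith

/-- `φ^B_{G,p,q}(A) > 0` for `p ∈ (0,1)`, `q > 0`, when the increasing event `A ≠ ∅` is determined by edges of `G`
(the all-open configuration `E(G)` lies in `A` and has positive weight). [cite: Grimmett2006, §1.2 eq. (1.2)] -/
theorem rcMeasure_real_pos_of_nonempty {p q : ℝ} (hp : p ∈ Set.Ioo (0 : ℝ) 1) (hq : 0 < q) (B : Set V)
    {F : Finset (Sym2 V)} (hF : (↑F : Set (Sym2 V)) ⊆ G.edgeSet) {A : Set (BondConfig V)} (hA : IsUpperSet A)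
    (hAF : DeterminedBy A (↑F : Set (Sym2 V))) (hne : A.Nonempty) :
    0 < (rcMeasure G p q B).real A := by
  have hpI : p ∈ Set.Icc (0 : ℝ) 1 := ⟨hp.1.le, hp.2.le⟩
  have hZ := rcPartitionFunction_pos G hpI hq B
  obtain ⟨ζ, hζ⟩ := hne
  have hE : (↑G.edgeFinset : BondConfig V) ∈ A := by
    have h1 := union_mem_of_determinedBy hA hAF hζ (↑G.edgeFinset : BondConfig V)
    have h2 : (↑G.edgeFinset : BondConfig V) ∪ ↑F = ↑G.edgeFinset := by
      rw [Set.union_eq_left]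
      intro e he
      simpa using hF he
    rwa [h2] at h1
  rw [rcMeasure_real_apply G hpI hq B A]
  have hnn : ∀ ω ∈ G.edgeFinset.powerset,
      0 ≤ (if (↑ω : BondConfig V) ∈ A then rcWeight G p q B ω / rcPartitionFunction G p q B else 0) := by
    intro ω _
    split_ifs
    · exact div_nonneg (rcWeight_nonneg G hpI hq.le B ω) hZ.le
    · exact le_rfl
  refine lt_of_lt_of_le ?_ (Finset.single_le_sum hnn (Finset.mem_powerset_self _))
  rw [if_pos hE]
  refine div_pos ?_ hZ
  simp only [rcWeight, Finset.sdiff_self, Finset.card_empty, pow_zero, mul_one]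
  exact mul_pos (pow_pos hp.1 _) (pow_pos hq _)

/-- **Theorem (3.42) with Russo's formula**: for `p ∈ (0,1)`, `q ≥ 1`, `r ↦ φ^B_{G,r,q}(A)` is differentiable at
`p` with derivative `D = cov(|η|, 1_A)/(p(1-p))` (Thm. (2.43)) and `φ_p(A) · φ_p(H_A^F) ≤ p(1-p) · D`, i.e.
`d/dp log φ_{p,q}(A) ≥ φ_{p,q}(H_A)/(p(1-p))`. [cite: Grimmett2006, Thm. (3.42) eq. (3.43)] -/
theorem hasDerivAt_rcMeasure_real_and_mul_sum_le {p q : ℝ} (hp : p ∈ Set.Ioo (0 : ℝ) 1) (hq : 1 ≤ q)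
    (B : Set V) {F : Finset (Sym2 V)} {A : Set (BondConfig V)} (hA : IsUpperSet A)
    (hAF : DeterminedBy A (↑F : Set (Sym2 V))) (hne : A.Nonempty) :
    ∃ D : ℝ, HasDerivAt (fun r => (rcMeasure G r q B).real A) D p ∧
      (rcMeasure G p q B).real A *
          ∑ k ∈ Finset.range F.card, (1 - (rcMeasure G p q B).real (withinDist F A k)) ≤ p * (1 - p) * D := by
  have hq0 : 0 < q := one_pos.trans_le hq
  have hpI : p ∈ Set.Icc (0 : ℝ) 1 := ⟨hp.1.le, hp.2.le⟩
  refine ⟨_, hasDerivAt_rcMeasure_real G hq0 B A hp, ?_⟩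
  have hpp : 0 < p * (1 - p) := mul_pos hp.1 (sub_pos.2 hp.2)
  rw [mul_div_cancel₀ _ hpp.ne']
  exact rcMeasure_real_mul_sum_le_cov G hpI hq B hA hAF hne

end FiniteGraph

end FK

end Summit.CriticalPhenomena.PercolationContinuityZ3.Theorems

end
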